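import Summits.PneNP.PneNP.Theorems.SymmetryBudgetWindowCanoniserComplete1

/-!
# Window canoniser, XXIX: completeness, II — the children of a reached label are reached

Route `PneNP/SymmetryBudget`, dichotomy `WindowBarrier` (stmt-PneNP-2145) / `NoHiddenOrder` (stmt-PneNP-14781);
continuation of `…WindowCanoniserComplete1.lean`.  Labels that agree on what a step reads step alike
(`WCan.step_congr`).  For a reached inner label `L` with CONNECTED arrival state and a vertex `xv` of its branching
cell `A`, the candidate child `L.cand xv (|A| - 1)` replays along `L` (`WCan.traj_cand`) — at an earlier
branching whose cell contains `xv` the recorded height `|A| - 1` is smaller than the height `|A'| - 1` of the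
vertex selected there, because `A ⊊ A'` (`WCan.selSet_cand_eq`, the anti-layering of the certified labels) — and
is reached at time `t + 1` (`WCan.good_cand`); for a DISCONNECTED arrival state every part child is reached at
`t + 1` (`WCan.good_part`).
-/

-- `Summit.PneNP.PneNP.…` duplicates `PneNP` BY DESIGN (single-problem summit, D-0017 layout).
set_option linter.dupNamespace false

noncomputable section

namespace Summit.PneNP.PneNP.Theorems

namespace WCan

open Finset Literature.Computability.Complexity Literature.Computability.Complexity.CGCanon
  Literature.Combinatorics.SimpleGraph ColourRefinementScheme
open scoped Classical

variable {K r n : ℕ}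

/-! ### Labels that read alike step alike -/

/-- **Labels that agree on what an unfrozen step reads step alike.** -/
theorem step_congr {L L' : RawLab n} (x : Fin (r + n) × Fin (r + n) → Bool) {S : St n} (hf : ¬ frzP L S) (hf' : ¬ frzP L' S)
    (hsel : IsConn (G x) S.W S.c → selSet L' S = selSet L S)
    (hsec : ¬ IsConn (G x) S.W S.c → secW L' x S = secW L x S)
    (hpok : ¬ IsConn (G x) S.W S.c → (pokP L' x S ↔ pokP L x S)) : step L' x S = step L x S := by
  have hn1 : ¬ nowP L S := fun h => hf (Or.inr (Or.inl h))
  have hn2 : ¬ nowP L' S := fun h => hf' (Or.inr (Or.inl h))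
  by_cases hc : IsConn (G x) S.W S.c
  · have hs := hsel hc
    have hind : indCol L' S = indCol L S := by simp only [indCol, hs]
    simp only [step, hf, hf', hc, hs, hind, hn1, hn2, ↓reduceIte, not_true_eq_false, false_and, or_false, decide_false,
      Bool.or_false]
  · have h1 := hsec hc
    have h2 := hpok hc
    simp only [step, hf, hf', hc, h1, hn1, hn2, h2, ↓reduceIte, false_and, false_or, not_false_eq_true, true_and, decide_false,
      Bool.or_false]

/-- At an unfrozen individualisation step the selected vertices are consumed. -/
theorem selSet_subset_step_C (L : RawLab n) (x : Fin (r + n) × Fin (r + n) → Bool) {S : St n} (hf : ¬ frzP L S)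
    (hc : IsConn (G x) S.W S.c) : selSet L S ⊆ (step L x S).C := by
  simp only [step, hf, hc, ↓reduceIte]; exact subset_union_right

/-! ### The candidate child -/

section Cand

/-- The recorded height of the new vertex: `|A| - 1`. -/
def hgt (L : RawLab n) (x : Fin (r + n) × Fin (r + n) → Bool) (t : ℕ) : Fin (n + 1) :=
  ⟨(bigMinCell (rs L x t).W (rs L x t).c).card - 1, by
    have : (bigMinCell (rs L x t).W (rs L x t).c).card ≤ n := (card_le_univ _).trans_eq (by simp)
    omega⟩

/-- The candidate child label. -/
abbrev candL (L : RawLab n) (x : Fin (r + n) × Fin (r + n) → Bool) (t : ℕ) (xv : Fin n) : RawLab n := L.cand xv (hgt L x t)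

/-- Its vertex set. -/
theorem candL_U (L : RawLab n) (x : Fin (r + n) × Fin (r + n) → Bool) (t : ℕ) (xv : Fin n) : (candL L x t xv).U = L.U := rfl

variable {L : RawLab n} {x : Fin (r + n) × Fin (r + n) → Bool} {t : ℕ} (g : Good L x t) (hU : ¬ L.U.card ≤ 1)
  (hconn : IsConn (G x) (rs L x t).W (rs L x t).c) {xv : Fin n} (hxv : xv ∈ bigMinCell (rs L x t).W (rs L x t).c)
include g hxv

/-- **A vertex of the branching cell is fresh.** -/
theorem xv_notin_X : xv ∉ L.X := by
  intro hX
  obtain ⟨hxW, h2, -⟩ := mem_bigMinCell.1 hxv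
  have hsing := singInv_rs L x t xv (g.now.2.symm ▸ hX) hxW
  have : (cell (rs L x t).W (rs L x t).c xv).card ≤ 1 := card_le_one.2 fun a ha b hb => by
    rw [mem_cell] at ha hb
    rw [hsing a ha.1 ha.2, hsing b hb.1 hb.2]
  omega

omit hxv in
/-- The child is unfrozen wherever `L` is, up to the arrival of `L`. -/
theorem not_frz_cand (hxX : xv ∉ L.X) {s : ℕ} (hs : s ≤ t) : ¬ frzP (candL L x t xv) (rs L x s) := by
  rintro (h | h | h)
  · rw [g.arr_eq_false hs] at h; exact Bool.false_ne_true h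
  · have hC := rs_C_subset_X L x s
    have : xv ∈ (rs L x s).C := by rw [h.2]; exact mem_insert_self _ _
    exact hxX (hC this)
  · rw [g.dead_eq_false hs] at h; exact Bool.false_ne_true h

/-- **Anti-layering**: at an earlier individualisation step, the child selects what `L` selects. -/
theorem selSet_cand_eq {s : ℕ} (hs : s < t) (hc : IsConn (G x) (rs L x s).W (rs L x s).c) :
    selSet (candL L x t xv) (rs L x s) = selSet L (rs L x s) := by
  have hxX := xv_notin_X g hxv
  obtain ⟨y, hy, hlam⟩ := g.sel s hs hc
  have hysel : y ∈ selSet L (rs L x s) := by rw [hy]; exact mem_singleton_self _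
  obtain ⟨hyA, hyX, hyC, hymax⟩ := (mem_selSet L).1 hysel
  have hyx : y ≠ xv := fun h => hxX (h ▸ hyX)
  -- the key inequality: if `xv` lies in the earlier branching cell `A'`, then `|A| < |A'|`
  have key : xv ∈ bigMinCell (rs L x s).W (rs L x s).c →
      (bigMinCell (rs L x t).W (rs L x t).c).card + 1 ≤ (bigMinCell (rs L x s).W (rs L x s).c).card := by
    intro hxA'
    have hyCt : y ∈ (rs L x t).C := by
      have h1 : y ∈ (rs L x (s + 1)).C := by rw [rs_succ]; exact selSet_subset_step_C L x (g.nfz s hs) hc hysel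
      exact rs_C_mono L x (by omega : s + 1 ≤ t) h1
    have hsub : bigMinCell (rs L x t).W (rs L x t).c ⊆ (bigMinCell (rs L x s).W (rs L x s).c).erase y := by
      intro w hw
      rw [bigMinCell_eq_cell hxv, mem_cell] at hw
      rw [mem_erase, bigMinCell_eq_cell hxA', mem_cell]
      have hxWt : xv ∈ (rs L x t).W := (mem_bigMinCell.1 hxv).1
      refine ⟨fun hwy => ?_, rs_W_anti L x hs.le hw.1, rs_ker L x hs.le hw.1 hxWt hw.2⟩
      subst hwy
      exact hyx (singInv_rs L x t _ hyCt hw.1 xv hxWt hw.2.symm).symm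
    have := card_le_card hsub
    rw [card_erase_of_mem hyA] at this
    have hpos : 0 < (bigMinCell (rs L x s).W (rs L x s).c).card := card_pos.2 ⟨y, hyA⟩
    omega
  have hApos : 2 ≤ (bigMinCell (rs L x t).W (rs L x t).c).card := by
    rw [bigMinCell_eq_cell hxv]; exact (mem_bigMinCell.1 hxv).2.1
  -- heights in the child
  have hlam' : ∀ w, (candL L x t xv).lam w = if w = xv then hgt L x t else L.lam w := fun w => by
    simp only [candL, RawLab.cand_lam, Function.update_apply]
  ext v
  rw [hy, mem_singleton, mem_selSet]
  simp only [candL, RawLab.cand_X, mem_insert]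
  constructor
  · rintro ⟨hvA, hvX, hvC, hvmax⟩
    by_contra hvy
    have := hvmax y hyA (Or.inr hyX) hyC (Ne.symm hvy)
    rw [hlam', hlam', if_neg hyx] at this
    rcases hvX with rfl | hvX
    · rw [if_pos rfl] at this
      have hk := key hvA
      have hlt : (L.lam y : ℕ) < ((hgt L x t : Fin (n + 1)) : ℕ) := this
      simp only [hgt] at hlt
      omega
    · have hvx : v ≠ xv := fun h => hxX (h ▸ hvX)
      rw [if_neg hvx] at this
      exact absurd (hymax v hvA hvX hvC hvy) (not_lt.2 this.le)
  · intro hvy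
    rw [hvy]
    refine ⟨hyA, Or.inr hyX, hyC, fun w hwA hwX hwC hwy => ?_⟩
    rw [hlam', hlam', if_neg hyx]
    rcases hwX with rfl | hwX
    · rw [if_pos rfl]
      have hk := key hwA
      show ((hgt L x t : Fin (n + 1)) : ℕ) < L.lam y
      simp only [hgt]
      omega
    · have hwx : w ≠ xv := fun h => hxX (h ▸ hwX)
      rw [if_neg hwx]
      exact hymax w hwA hwX hwC hwy

/-- **The candidate child replays along `L`.** -/
theorem traj_cand {s : ℕ} (hs : s ≤ t) : rs (candL L x t xv) x s = rs L x s := by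
  have hxX := xv_notin_X g hxv
  induction s with
  | zero => rfl
  | succ s ih =>
    have ih' := ih (by omega)
    rw [rs_succ, rs_succ, ih']
    exact step_congr x (g.nfz s (by omega)) (not_frz_cand g hxX (by omega)) (fun hc => selSet_cand_eq g hxv (by omega) hc)
      (fun _ => by rw [secW, secW, candL_U]) (fun _ => by rw [pokP, pokP, candL_U])

/-- At the arrival state of `L` the child selects `xv`. -/
theorem selSet_cand_t : selSet (candL L x t xv) (rs L x t) = {xv} := by
  have hxX := xv_notin_X g hxv
  ext v
  rw [mem_selSet, mem_singleton]
  simp only [candL, RawLab.cand_X, mem_insert, g.now.2]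
  constructor
  · rintro ⟨-, hvX, hvC, -⟩
    rcases hvX with rfl | hvX
    · rfl
    · exact absurd hvX hvC
  · rintro rfl
    exact ⟨hxv, Or.inl rfl, hxX, fun w _ hwX hwC hwx => by rcases hwX with rfl | hwX <;> [exact absurd rfl hwx; exact absurd hwX hwC]⟩

include hU hconn in
/-- The state of the child right after the arrival state of `L`. -/
theorem rs_cand_succ : (rs (candL L x t xv) x (t + 1)).W = L.U ∧
    (rs (candL L x t xv) x (t + 1)).c = crRefine (G x) L.U (individualize (rs L x t).c xv) ∧
    (rs (candL L x t xv) x (t + 1)).C = insert xv L.X ∧ (rs (candL L x t xv) x (t + 1)).dead = false := by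
  have hxX := xv_notin_X g hxv
  have hf := not_frz_cand g hxX le_rfl
  have hsel := selSet_cand_t g hxv
  have hW := g.now.1
  have hind : indCol (candL L x t xv) (rs L x t) = individualize (rs L x t).c xv :=
    indCol_of_mem _ (by rw [hsel]; exact mem_singleton_self _)
  rw [rs_succ, traj_cand g hxv le_rfl]
  refine ⟨by simp only [step, hf, hconn, ↓reduceIte]; exact hW, by simp only [step, hf, hconn, ↓reduceIte, hind]; rw [hW], ?_, ?_⟩
  · simp only [step, hf, hconn, ↓reduceIte, hsel, g.now.2]
    ext v; simp
  · have hWc : ¬ (rs L x t).W.card ≤ 1 := by rw [hW]; exact hU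
    simp [step, hf, hconn, hsel, g.dead_eq_false le_rfl, hWc]

include hU hconn in
/-- **The candidate child is reached at time `t + 1`.** -/
theorem good_cand : Good (candL L x t xv) x (t + 1) := by
  have hxX := xv_notin_X g hxv
  obtain ⟨hW1, hc1, hC1, hd1⟩ := rs_cand_succ g hU hconn hxv
  have hA : 1 ≤ (bigMinCell (rs L x t).W (rs L x t).c).card := card_pos.2 ⟨xv, hxv⟩
  refine ⟨fun s hs => ?_, ⟨hW1, hC1⟩, hd1, ?_, fun s hs hc => ?_, ?_, ?_, fun v hv => ?_⟩
  · rw [traj_cand g hxv (by omega)]; exact not_frz_cand g hxX (by omega)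
  · simp only [candL, RawLab.cand_X, RawLab.cand_U, card_insert_of_notMem hxX]
    have := g.tle; omega
  · rcases Nat.lt_succ_iff_lt_or_eq.1 hs with hs | rfl
    · rw [traj_cand g hxv hs.le] at hc ⊢
      obtain ⟨y, hy, hlam⟩ := g.sel s hs hc
      refine ⟨y, by rw [selSet_cand_eq g hxv hs hc, hy], ?_⟩
      have hyx : y ≠ xv := by
        intro h
        have : y ∈ selSet L (rs L x s) := by rw [hy]; exact mem_singleton_self _
        exact hxX (h ▸ ((mem_selSet L).1 this).2.1)
      simp only [candL, RawLab.cand_lam, Function.update_apply, if_neg hyx, hlam]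
    · rw [traj_cand g hxv le_rfl] at hc ⊢
      refine ⟨xv, selSet_cand_t g hxv, ?_⟩
      simp only [candL, RawLab.cand_lam, Function.update_self, hgt]
      omega
  · rw [hW1, hc1]; exact crRefine_isEqui
  · -- the budget: `∏` gains the factor `|A|`, `lam` loses it
    simp only [candL, RawLab.cand_X, RawLab.cand_U, RawLab.cand_lam]
    rw [prod_insert hxX, Function.update_self, hc1]
    have hprod : ∏ v ∈ L.X, ((Function.update L.lam xv (hgt L x t) v : ℕ) + 1) = ∏ v ∈ L.X, ((L.lam v : ℕ) + 1) :=
      prod_congr rfl fun v hv => by rw [Function.update_apply, if_neg (show v ≠ xv from fun h => hxX (h ▸ hv))]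
    rw [hprod]
    have hh : ((hgt L x t : Fin (n + 1)) : ℕ) + 1 = (bigMinCell (rs L x t).W (rs L x t).c).card := by
      simp only [hgt]; omega
    rw [hh]
    have hWU := g.now.1
    have hlam := lam_of_isConn (R := crRefiner n) (G := G x) (c := (rs L x t).c) (by rw [hWU]; exact hU) hconn ⟨xv, hxv⟩
    rw [hWU] at hlam hxv ⊢
    have hle : CGCanon.lam (crRefiner n) (G x) L.U ((crRefiner n).refine (G x) L.U (individualize (rs L x t).c xv)) ≤
        (bigMinCell L.U (rs L x t).c).attach.sup fun a => CGCanon.lam (crRefiner n) (G x) L.U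
          ((crRefiner n).refine (G x) L.U (individualize (rs L x t).c a.1)) :=
      Finset.le_sup (f := fun a : {a // a ∈ bigMinCell L.U (rs L x t).c} =>
        CGCanon.lam (crRefiner n) (G x) L.U ((crRefiner n).refine (G x) L.U (individualize (rs L x t).c a.1))) (mem_attach _ ⟨xv, hxv⟩)
    have hb := g.budget
    calc (bigMinCell L.U (rs L x t).c).card * (∏ v ∈ L.X, ((L.lam v : ℕ) + 1)) *
          CGCanon.lam (crRefiner n) (G x) L.U (crRefine (G x) L.U (individualize (rs L x t).c xv))
        = (∏ v ∈ L.X, ((L.lam v : ℕ) + 1)) * ((bigMinCell L.U (rs L x t).c).card *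
            CGCanon.lam (crRefiner n) (G x) L.U ((crRefiner n).refine (G x) L.U (individualize (rs L x t).c xv))) := by
          rw [crRefiner_refine]; ring
      _ ≤ (∏ v ∈ L.X, ((L.lam v : ℕ) + 1)) * CGCanon.lam (crRefiner n) (G x) L.U (rs L x t).c := by
          rw [hlam]; exact Nat.mul_le_mul_left _ (Nat.mul_le_mul_left _ hle)
      _ ≤ 2 ^ B₀ n := hb
  · simp only [candL, RawLab.cand_X, mem_insert, not_or] at hv
    simp only [candL, RawLab.cand_lam, Function.update_apply, if_neg hv.1, g.lam0 v hv.2]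

end Cand

/-! ### The part child -/

section Part

/-- The part child label of the part of `u`. -/
abbrev partL (L : RawLab n) (x : Fin (r + n) × Fin (r + n) → Bool) (t : ℕ) (u : Fin n) : RawLab n :=
  L.part (comp (G x) (rs L x t).W (rs L x t).c u)

variable {L : RawLab n} {x : Fin (r + n) × Fin (r + n) → Bool} {t : ℕ} (g : Good L x t) (hU : ¬ L.U.card ≤ 1)
  (hnc : ¬ IsConn (G x) (rs L x t).W (rs L x t).c) {u : Fin n} (hu : u ∈ L.U)
include g hU hnc hu

omit hU hu in
/-- The part is a proper subset of `U`. -/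
theorem part_ssubset : comp (G x) (rs L x t).W (rs L x t).c u ⊂ L.U := g.now.1 ▸ comp_ssubset_of_not_isConn hnc u

omit hU hnc hu in
/-- The child is unfrozen wherever `L` is, up to the arrival of `L`. -/
theorem not_frz_part (hss : comp (G x) (rs L x t).W (rs L x t).c u ⊂ L.U) {s : ℕ} (hs : s ≤ t) : ¬ frzP (partL L x t u) (rs L x s) := by
  rintro (h | h | h)
  · rw [g.arr_eq_false hs] at h; exact Bool.false_ne_true h
  · have hW : L.U ⊆ (rs L x s).W := g.now.1 ▸ rs_W_anti L x hs
    rw [h.1] at hW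
    exact hss.2 hW
  · rw [g.dead_eq_false hs] at h; exact Bool.false_ne_true h

omit hU in
/-- **The part child replays along `L`.** -/
theorem traj_part {s : ℕ} (hs : s ≤ t) : rs (partL L x t u) x s = rs L x s := by
  have hss := part_ssubset (u := u) g hnc
  have hune : u ∈ comp (G x) (rs L x t).W (rs L x t).c u := mem_comp_self (g.now.1.symm ▸ hu)
  induction s with
  | zero => rfl
  | succ s ih =>
    have ih' := ih (by omega)
    rw [rs_succ, rs_succ, ih']
    have hs' : s < t := by omega
    obtain ⟨-, -, hpk⟩ := g.facts_of_step hs'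
    refine step_congr x (g.nfz s hs') (not_frz_part g hss (by omega)) (fun _ => rfl) (fun hc => ?_) (fun hc => ?_)
    · obtain ⟨hall, -⟩ := hpk hc
      ext v
      simp only [secW, mem_filter, partL, RawLab.part_U]
      constructor
      · rintro ⟨hv, a, ha, haW, hav⟩; exact ⟨hv, a, hss.1 ha, haW, hav⟩
      · rintro ⟨hv, a, ha, -, hav⟩
        obtain ⟨huW, hua⟩ := hall u hu a ha
        exact ⟨hv, u, hune, huW, hua.trans hav⟩
    · obtain ⟨hall, hne⟩ := hpk hc
      refine iff_of_true ⟨fun a ha a' ha' => hall a (hss.1 ha) a' (hss.1 ha'), ⟨u, hune⟩⟩ ⟨hall, hne⟩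

/-- The state of the child right after the arrival state of `L`. -/
theorem rs_part_succ : (rs (partL L x t u) x (t + 1)).W = comp (G x) (rs L x t).W (rs L x t).c u ∧
    (rs (partL L x t u) x (t + 1)).c = (rs L x t).c ∧
    (rs (partL L x t u) x (t + 1)).C = L.X ∧ (rs (partL L x t u) x (t + 1)).dead = false := by
  have hss := part_ssubset (u := u) g hnc
  have hf := not_frz_part g hss le_rfl
  have huW : u ∈ (rs L x t).W := g.now.1.symm ▸ hu
  have h2 : ¬ (rs L x t).W.card ≤ 1 := by rw [g.now.1]; exact hU
  obtain ⟨hW, hc, hC, hd⟩ := part_step (partL L x t u) x hf hnc huW rfl h2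
  rw [rs_succ, traj_part g hnc hu le_rfl]
  exact ⟨hW, hc, hC.trans g.now.2, hd.trans (g.dead_eq_false le_rfl)⟩

/-- **The part child is reached at time `t + 1`.** -/
theorem good_part : Good (partL L x t u) x (t + 1) := by
  have hss := part_ssubset (u := u) g hnc
  obtain ⟨hW1, hc1, hC1, hd1⟩ := rs_part_succ g hU hnc hu
  refine ⟨fun s hs => ?_, ⟨hW1, hC1⟩, hd1, ?_, fun s hs hc => ?_, ?_, ?_, fun v hv => g.lam0 v hv⟩
  · rw [traj_part g hnc hu (by omega)]; exact not_frz_part g hss (by omega)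
  · simp only [partL, RawLab.part_X, RawLab.part_U]
    have h1 := card_lt_card hss
    have h2 : L.U.card ≤ n := (card_le_univ _).trans_eq (by simp)
    have := g.tle; omega
  · rcases Nat.lt_succ_iff_lt_or_eq.1 hs with hs | rfl
    · rw [traj_part g hnc hu hs.le] at hc ⊢
      exact g.sel s hs hc
    · rw [traj_part g hnc hu le_rfl] at hc; exact absurd hc hnc
  · rw [hW1, hc1]; exact g.equi.of_closed (comp_closed u)
  · simp only [partL, RawLab.part_X, RawLab.part_U, RawLab.part_lam]
    rw [hc1]
    refine le_trans (Nat.mul_le_mul_left _ ?_) g.budget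
    have hWU := g.now.1
    have h2 : ¬ (rs L x t).W.card ≤ 1 := by rw [hWU]; exact hU
    have hmem : comp (G x) (rs L x t).W (rs L x t).c u ∈ parts (G x) (rs L x t).W (rs L x t).c :=
      mem_image_of_mem _ (hWU.symm ▸ hu)
    rw [← hWU, lam_of_not_isConn h2 hnc]
    exact Finset.le_sup (f := fun Kc : {Kc // Kc ∈ parts (G x) (rs L x t).W (rs L x t).c} =>
      CGCanon.lam (crRefiner n) (G x) Kc.1 (rs L x t).c) (mem_attach _ ⟨_, hmem⟩)

end Part

end WCan

end Summit.PneNP.PneNP.Theorems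

end
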